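import Mathlib.Algebra.QuadraticAlgebra.Defs
import Mathlib.Data.ZMod.Basic
import Summits.MatrixMultiplication.OmegaCensus.MetacyclicBoxPattern

/-!
# ω-census, family (b3): `R ⋊_u ℤ/q` for a finite commutative ring `R` — the ring-generic `MetaCyc`, its box-pattern reduction, and the Eisenstein groups `𝔽_p[ω] ⋊ C₃`

HONEST FRAMING (pub-omega census; verbatim): lottery ticket; floor = certified bounds/negative ranges.
Census BOOKKEEPING (conjecture C9 of the cell; pub-omega stpp-1 gen 21).  `MetaCyc N q u = ℤ/N ⋊_u ℤ/q` (`MetaCyclic.lean`) and its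
box-pattern reduction (`MetacyclicBoxPattern.lean`) use nothing about `ℤ/N` beyond being a commutative ring containing `u` with
`u^q = 1`.  This file is the VERBATIM generalisation to a finite commutative ring `R`: the group `RCyc R q u` (elements `a^i b^t`,
`i : R`, `t : ZMod q`, `(i,t)(j,s) = (i + u^t j, t + s)`), boxes `RBox R q`, cells, the key identity `RBox.cellWord_cell`
(two cells interact only if their levels differ by `σ(c) − σ(c')` and their coordinates by `dd c c'`), `PatIndep`, `cellSet`,
`card_cellSet`, and **`RBox.not_boxUseful_of_pattern`**: an independent pattern `T ⊆ (Fin 3 × Fin 3) × R` with `9|R| ≤ 5·#T`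
makes `RCyc R q u` not box-useful (+ lifts along surjections / injections).  TARGET FAMILY: the Schmidt atoms
`A(p,3) = 𝔽_{p²} ⋊ C₃` for `p ≡ 2 (mod 3)` — realised for EVERY `p` as `EisCyc p := RCyc (𝔽_p[ω]) 3 ω` with
`𝔽_p[ω] = QuadraticAlgebra (ZMod p) (-1) (-1)` (`ω² = −1 − ω`, so `ω³ = 1`: `omega_cube`), order `3p²` (`EisCyc.card`); for
`p = 2` this is `A₄`.  (Planning note HOME/pub-omega-stpp-1-g21/ATOMS-NONNILPOTENT-C9.md.)  Nothing here is progress on `ω`.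
-/

namespace Summit.MatrixMultiplication.OmegaCensus

open Finset ProductBoxBound

/-- The split extension `R ⋊_u ℤ/q` of the additive group of a commutative ring `R` by `ℤ/q` acting through multiplication by the
powers of `u ∈ R` (`u^q = 1`): elements `a^i b^t` as pairs `(i : R, t : ZMod q)`. [folklore] -/
structure RCyc (R : Type*) (q : ℕ) (u : R) where
  /-- the `R`-coordinate (exponent of `a`) -/
  i : R
  /-- exponent of `b` -/
  t : ZMod q
  deriving DecidableEq

namespace RCyc

variable {R : Type*} [CommRing R] {q : ℕ} {u : R}

omit [CommRing R] in
/-- Two elements agree iff both coordinates agree. [folklore] -/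
@[ext] theorem ext {x y : RCyc R q u} (hi : x.i = y.i) (ht : x.t = y.t) : x = y := by
  cases x; cases y; congr

/-- `u^t` for an exponent `t : ZMod q` (through `t.val`). [folklore] -/
def act (u : R) (t : ZMod q) : R := u ^ t.val

/-- `(a^i b^t)(a^j b^s) = a^{i + u^t j} b^{t+s}`. [folklore] -/
instance : Mul (RCyc R q u) := ⟨fun x y => ⟨x.i + act u x.t * y.i, x.t + y.t⟩⟩

/-- Identity `a^0 b^0`. [folklore] -/
instance : One (RCyc R q u) := ⟨⟨0, 0⟩⟩

/-- Inverse `(a^i b^t)⁻¹ = a^{-u^{-t} i} b^{-t}`. [folklore] -/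
instance : Inv (RCyc R q u) := ⟨fun x => ⟨-(act u (-x.t) * x.i), -x.t⟩⟩

/-- The multiplication rule, unfolded. [folklore] -/
theorem mul_def (x y : RCyc R q u) : x * y = ⟨x.i + act u x.t * y.i, x.t + y.t⟩ := rfl
/-- The identity, unfolded. [folklore] -/
theorem one_def : (1 : RCyc R q u) = ⟨0, 0⟩ := rfl
/-- The inverse, unfolded. [folklore] -/
theorem inv_def (x : RCyc R q u) : x⁻¹ = ⟨-(act u (-x.t) * x.i), -x.t⟩ := rfl

/-- `u^q = 1` makes `t ↦ u^t` multiplicative on `ZMod q`. [folklore] -/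
theorem act_add [NeZero q] (hu : u ^ q = 1) (s t : ZMod q) : act u (s + t) = act u s * act u t := by
  unfold act
  rw [ZMod.val_add, ← pow_add]
  conv_rhs => rw [← Nat.mod_add_div (s.val + t.val) q, pow_add, pow_mul, hu, one_pow, mul_one]

/-- `u^0 = 1`. [folklore] -/
theorem act_zero : act u (0 : ZMod q) = 1 := by
  unfold act; rw [ZMod.val_zero, pow_zero]

/-- `RCyc R q u` is a group when `u^q = 1`. [folklore] -/
instance instGroup [NeZero q] [Fact (u ^ q = 1)] : Group (RCyc R q u) :=
  Group.ofLeftAxioms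
    (fun x y z => by
      apply ext
      · simp only [mul_def, act_add Fact.out]; ring
      · simp only [mul_def]; ring)
    (fun x => by
      apply ext
      · simp only [mul_def, one_def, act_zero]; ring
      · simp only [mul_def, one_def]; ring)
    (fun x => by
      apply ext
      · simp only [mul_def, inv_def, one_def]; ring
      · simp only [mul_def, inv_def, one_def]; ring)

/-- `RCyc R q u ≃ R × ZMod q` (as types). [folklore] -/
def equivProd : RCyc R q u ≃ R × ZMod q :=
  ⟨fun x => (x.i, x.t), fun p => ⟨p.1, p.2⟩, fun _ => rfl, fun _ => rfl⟩

/-- Finite, through `equivProd`. [folklore] -/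
instance [Fintype R] [NeZero q] : Fintype (RCyc R q u) := Fintype.ofEquiv _ equivProd.symm

omit [CommRing R] in
/-- `|R ⋊ ℤ/q| = |R| q`. [folklore] -/
theorem card [Fintype R] [NeZero q] : Fintype.card (RCyc R q u) = Fintype.card R * q := by
  rw [Fintype.ofEquiv_card, Fintype.card_prod, ZMod.card]

/-- `u^s · u^t = u^{s+t}`. [folklore] -/
theorem act_mul_act [NeZero q] (hu : u ^ q = 1) (s t : ZMod q) : act u s * act u t = act u (s + t) :=
  (act_add hu s t).symm

/-- `u^s · (u^t · x) = u^{s+t} · x`. [folklore] -/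
theorem act_mul_act_mul [NeZero q] (hu : u ^ q = 1) (s t : ZMod q) (x : R) :
    act u s * (act u t * x) = act u (s + t) * x := by
  rw [← mul_assoc, act_mul_act hu]

end RCyc

namespace RCyc

variable {R : Type*} [CommRing R] {q : ℕ} {u : R}

/-- Box data for `RCyc R q u`: `y_i = a^{α i} b^{a i}`, `w_j = a^{β j} b^{b j}`. [folklore] -/
structure RBox (R : Type*) (q : ℕ) where
  /-- `a`-exponents of `y₀, y₁, y₂` -/
  α : Fin 3 → R
  /-- `b`-exponents of `y₀, y₁, y₂` -/
  a : Fin 3 → ZMod q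
  /-- `a`-exponents of `w₀, w₁, w₂` -/
  β : Fin 3 → R
  /-- `b`-exponents of `w₀, w₁, w₂` -/
  b : Fin 3 → ZMod q

namespace RBox

variable (D : RBox R q) (u)

/-- The `Y`-element `y_i = a^{α i} b^{a i}`. [folklore] -/
def yEl (i : Fin 3) : RCyc R q u := ⟨D.α i, D.a i⟩

/-- The `W`-element `w_j = a^{β j} b^{b j}`. [folklore] -/
def wEl (j : Fin 3) : RCyc R q u := ⟨D.β j, D.b j⟩

/-- The `b`-exponent sum `σ(c) = a i + b j` of the column `c = (i, j)`. [folklore] -/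
def sig (c : Fin 3 × Fin 3) : ZMod q := D.a c.1 + D.b c.2

/-- The forbidden coordinate difference from column `c = (i,j)` to column `c' = (i',j')`:
`u^{a_i + b_{j'}} (α_{i'} − β_j) + u^{a_i + b_j} β_{j'} − u^{a_{i'} + b_{j'}} α_i`. [folklore] -/
def dd (c c' : Fin 3 × Fin 3) : R :=
  act u (D.a c.1 + D.b c'.2) * (D.α c'.1 - D.β c.2) + act u (D.a c.1 + D.b c.2) * D.β c'.2
    - act u (D.a c'.1 + D.b c'.2) * D.α c.1

/-- The cell of column `c = (i,j)` at coordinate `A` and level `t`: `(a^{u^{-σ(c)} A} b^t, y_i, w_j)`. [folklore] -/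
def cell (c : Fin 3 × Fin 3) (A : R) (t : ZMod q) : RCyc R q u × RCyc R q u × RCyc R q u :=
  (⟨act u (-D.sig c) * A, t⟩, D.yEl u c.1, D.wEl u c.2)

/-- The `ℤ/q`-part of a cell word is the signed sum of the `b`-exponents. [folklore] -/
theorem cellWord_t [NeZero q] [Fact (u ^ q = 1)] (x y w x' y' w' : RCyc R q u) :
    (cellWord (x, y, w) (x', y', w')).t = x.t - x'.t + (y.t - y'.t) + (w.t - w'.t) := by
  simp only [cellWord, RCyc.mul_def, RCyc.inv_def]; ring

/-- The `ℤ/N`-part of a cell word, powers of `u` collected. [folklore] -/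
theorem cellWord_i [NeZero q] [Fact (u ^ q = 1)] (x y w x' y' w' : RCyc R q u) :
    (cellWord (x, y, w) (x', y', w')).i =
      x.i - act u (x.t + -x'.t) * x'.i
        + act u (x.t + -x'.t) * (y.i - act u (y.t + -y'.t) * y'.i)
        + act u (x.t + -x'.t + (y.t + -y'.t)) * (w.i - act u (w.t + -w'.t) * w'.i) := by
  have hu : u ^ q = 1 := Fact.out
  simp only [cellWord, RCyc.mul_def, RCyc.inv_def, mul_neg, act_mul_act_mul hu]
  ring

/-- **Key identity.** Two cells interact only if their levels differ by `σ(c) − σ(c')` and their coordinates by `dd c c'`.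
[folklore] -/
theorem cellWord_cell [NeZero q] [Fact (u ^ q = 1)] {c c' : Fin 3 × Fin 3} {A A' : R} {t t' : ZMod q}
    (hw : cellWord (D.cell u c A t) (D.cell u c' A' t') = 1) :
    t' = t + D.sig c - D.sig c' ∧ A - A' = D.dd u c c' := by
  have hu : u ^ q = 1 := Fact.out
  have ht := congrArg RCyc.t hw
  have hi := congrArg RCyc.i hw
  rw [cell, cell, cellWord_t] at ht
  rw [cell, cell, cellWord_i] at hi
  simp only [yEl, wEl, RCyc.one_def, sig] at ht hi ⊢
  have et : t' = t + (D.a c.1 + D.b c.2) - (D.a c'.1 + D.b c'.2) := by linear_combination -ht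
  refine ⟨et, ?_⟩
  subst et
  have h3 := congrArg (fun z => act u (D.a c.1 + D.b c.2) * z) hi
  simp only [mul_zero, mul_add, mul_sub, act_mul_act_mul hu] at h3
  simp only [dd]
  ring_nf at h3 ⊢
  simp only [act_zero, one_mul] at h3
  linear_combination h3

/-- The injectivity data of a nondegenerate box: the three `Y`-elements and the three `W`-elements are distinct. [folklore] -/
structure Nondeg : Prop where
  /-- the three `Y`-elements are distinct -/
  y_inj : Function.Injective (D.yEl u)
  /-- the three `W`-elements are distinct -/
  w_inj : Function.Injective (D.wEl u)

omit [CommRing R] in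
/-- Nondegeneracy from the injectivity of the two exponent maps `i ↦ (α i, a i)`, `j ↦ (β j, b j)`. [folklore] -/
theorem nondeg_of (hy : Function.Injective fun i => (D.α i, D.a i)) (hw : Function.Injective fun j => (D.β j, D.b j)) :
    D.Nondeg u :=
  ⟨fun i i' e => hy (by simp only [yEl, RCyc.mk.injEq] at e; exact Prod.ext e.1 e.2),
    fun j j' e => hw (by simp only [wEl, RCyc.mk.injEq] at e; exact Prod.ext e.1 e.2)⟩

/-- `u^t` is a unit (`u^q = 1`). [folklore] -/
theorem act_mul_cancel [NeZero q] (hu : u ^ q = 1) (s : ZMod q) {A A' : R} (h : act u s * A = act u s * A') :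
    A = A' := by
  have := congrArg (fun z => act u (-s) * z) h
  simpa only [act_mul_act_mul hu, neg_add_cancel, act_zero, one_mul] using this

/-- Cells determine their data (for a nondegenerate box). [folklore] -/
theorem cell_inj [NeZero q] [Fact (u ^ q = 1)] (hD : D.Nondeg u) {c c' : Fin 3 × Fin 3} {A A' : R}
    {t t' : ZMod q} (e : D.cell u c A t = D.cell u c' A' t') : c = c' ∧ A = A' ∧ t = t' := by
  simp only [cell, Prod.mk.injEq, RCyc.mk.injEq] at e
  obtain ⟨⟨e1, e2⟩, ey, ew⟩ := e
  have hc : c = c' := Prod.ext (hD.y_inj ey) (hD.w_inj ew)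
  subst hc
  exact ⟨rfl, act_mul_cancel u Fact.out _ e1, e2⟩

/-- A pattern `T ⊆ (Fin 3 × Fin 3) × R` (column, coordinate) is *independent* when no ordered pair of distinct entries
sits at a forbidden difference. [folklore] -/
def PatIndep (T : Finset ((Fin 3 × Fin 3) × R)) : Prop :=
  ∀ x ∈ T, ∀ y ∈ T, x ≠ y → x.2 - y.2 ≠ D.dd u x.1 y.1

/-- Pattern independence is decidable (finite quantifiers over `T`, equality in `R`). [folklore] -/
instance (T : Finset ((Fin 3 × Fin 3) × R)) [DecidableEq R] : Decidable (D.PatIndep u T) := by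
  unfold PatIndep; infer_instance

variable [Fintype R] [DecidableEq R] [NeZero q] [Fact (u ^ q = 1)]

/-- The cell set of a pattern: over every entry `(c, A)` the `q` cells of column `c` at coordinate `A` (all levels). [folklore] -/
def cellSet (T : Finset ((Fin 3 × Fin 3) × R)) : Finset (RCyc R q u × RCyc R q u × RCyc R q u) :=
  T.biUnion fun x => (univ : Finset (ZMod q)).image fun t => D.cell u x.1 x.2 t

omit [Fintype R] [Fact (u ^ q = 1)] in
/-- Membership in the cell set. [folklore] -/
theorem mem_cellSet {T : Finset ((Fin 3 × Fin 3) × R)} {P : RCyc R q u × RCyc R q u × RCyc R q u} :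
    P ∈ D.cellSet u T ↔ ∃ x ∈ T, ∃ t : ZMod q, P = D.cell u x.1 x.2 t := by
  constructor
  · intro hP
    obtain ⟨x, hx, hP⟩ := mem_biUnion.1 hP
    obtain ⟨t, -, ht⟩ := mem_image.1 hP
    exact ⟨x, hx, t, ht.symm⟩
  · rintro ⟨x, hx, t, rfl⟩
    exact mem_biUnion.2 ⟨x, hx, mem_image.2 ⟨t, mem_univ _, rfl⟩⟩

omit [Fact (u ^ q = 1)] in
/-- The cell set lies in the box `G × Y × W`, `Y = {y_i}`, `W = {w_j}`. [folklore] -/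
theorem cellSet_subset (T : Finset ((Fin 3 × Fin 3) × R)) :
    D.cellSet u T ⊆ univ ×ˢ ((univ.image (D.yEl u)) ×ˢ (univ.image (D.wEl u))) := by
  intro P hP
  obtain ⟨x, -, t, rfl⟩ := (D.mem_cellSet u).1 hP
  simp only [cell, mem_product, mem_univ, true_and, mem_image]
  exact ⟨⟨x.1.1, rfl⟩, ⟨x.1.2, rfl⟩⟩

omit [Fintype R] in
/-- The cell set has `#T · q` cells (nondegenerate box). [folklore] -/
theorem card_cellSet (hD : D.Nondeg u) (T : Finset ((Fin 3 × Fin 3) × R)) : #(D.cellSet u T) = #T * q := by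
  have hinj : ∀ x : (Fin 3 × Fin 3) × R, Function.Injective (fun t : ZMod q => D.cell u x.1 x.2 t) := by
    intro x t t' e
    exact (D.cell_inj u hD e).2.2
  rw [cellSet, card_biUnion]
  · have : ∀ x ∈ T, #((univ : Finset (ZMod q)).image fun t => D.cell u x.1 x.2 t) = q := fun x _ => by
      rw [card_image_of_injective _ (hinj x), card_univ, ZMod.card]
    rw [sum_congr rfl this, sum_const, smul_eq_mul]
  · intro x _ y _ hxy
    rw [Function.onFun, disjoint_left]
    intro P hPx hPy
    obtain ⟨t, -, rfl⟩ := mem_image.1 hPx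
    obtain ⟨t', -, e⟩ := mem_image.1 hPy
    obtain ⟨hc, hA, -⟩ := D.cell_inj u hD e.symm
    exact hxy (Prod.ext hc hA)

omit [Fintype R] in
/-- An independent pattern gives an independent cell set. [folklore] -/
theorem cellSet_indep {T : Finset ((Fin 3 × Fin 3) × R)} (hT : D.PatIndep u T) :
    ∀ P ∈ D.cellSet u T, ∀ P' ∈ D.cellSet u T, P ≠ P' → cellWord P P' ≠ 1 := by
  intro P hP P' hP' hne hw
  obtain ⟨x, hx, t, rfl⟩ := (D.mem_cellSet u).1 hP
  obtain ⟨y, hy, t', rfl⟩ := (D.mem_cellSet u).1 hP'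
  obtain ⟨e1, e2⟩ := D.cellWord_cell u hw
  by_cases hxy : x = y
  · subst hxy
    apply hne
    have h1 : t' = t := by rw [e1]; ring
    rw [h1]
  · exact hT x hx y hy hxy e2

/-- **Witness form of the pattern lemma**: an independent pattern `T` for a nondegenerate box gives a `3 × 3` box of
`RCyc R q u` with an independent cell set of exactly `#T · q` cells. [folklore] -/
theorem exists_indep_of_pattern (hD : D.Nondeg u) {T : Finset ((Fin 3 × Fin 3) × R)} (hT : D.PatIndep u T) :
    ∃ (Y W : Finset (RCyc R q u)) (I : Finset (RCyc R q u × RCyc R q u × RCyc R q u)),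
      #Y = 3 ∧ #W = 3 ∧ I ⊆ univ ×ˢ (Y ×ˢ W) ∧ (∀ P ∈ I, ∀ P' ∈ I, P ≠ P' → cellWord P P' ≠ 1) ∧ #I = #T * q :=
  ⟨univ.image (D.yEl u), univ.image (D.wEl u), D.cellSet u T,
    by rw [card_image_of_injective _ hD.y_inj, card_univ, Fintype.card_fin],
    by rw [card_image_of_injective _ hD.w_inj, card_univ, Fintype.card_fin],
    D.cellSet_subset u T, D.cellSet_indep u hT, D.card_cellSet u hD T⟩

/-- **The pattern lemma**: an independent pattern with `9|R| ≤ 5·#T` makes `RCyc R q u` not box-useful. [folklore] -/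
theorem not_boxUseful_of_pattern (hD : D.Nondeg u) {T : Finset ((Fin 3 × Fin 3) × R)} (hT : D.PatIndep u T)
    (hbig : 9 * Fintype.card R ≤ 5 * #T) : ¬ BoxUseful (RCyc R q u) := by
  obtain ⟨Y, W, I, hY, hW, hI, hind, hcard⟩ := D.exists_indep_of_pattern u hD hT
  refine not_boxUseful_of_indep hY hW hI hind ?_
  rw [hcard, RCyc.card]
  calc 9 * (Fintype.card R * q) = (9 * Fintype.card R) * q := by ring
    _ ≤ (5 * #T) * q := Nat.mul_le_mul_right _ hbig
    _ = 5 * (#T * q) := by ring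

/-- Along a surjection `G ↠ RCyc R q u`, an independent pattern with `9|R| ≤ 5·#T` makes `G` not box-useful. [folklore] -/
theorem not_boxUseful_of_surjective_of_pattern (hD : D.Nondeg u) {T : Finset ((Fin 3 × Fin 3) × R)}
    (hT : D.PatIndep u T) (hbig : 9 * Fintype.card R ≤ 5 * #T) {G : Type*} [Group G] [Fintype G] [DecidableEq G]
    (f : G →* RCyc R q u) (hf : Function.Surjective f) : ¬ BoxUseful G := by
  obtain ⟨Y, W, I, hY, hW, hI, hind, hcard⟩ := D.exists_indep_of_pattern u hD hT
  refine not_boxUseful_of_surjective f hf hY hW hI hind ?_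
  rw [hcard, RCyc.card]
  calc 9 * (Fintype.card R * q) = (9 * Fintype.card R) * q := by ring
    _ ≤ (5 * #T) * q := Nat.mul_le_mul_right _ hbig
    _ = 5 * (#T * q) := by ring

/-- Along an injection `RCyc R q u ↪ G`, an independent pattern with `9|R| ≤ 5·#T` makes `G` not box-useful. [folklore] -/
theorem not_boxUseful_of_injective_of_pattern (hD : D.Nondeg u) {T : Finset ((Fin 3 × Fin 3) × R)}
    (hT : D.PatIndep u T) (hbig : 9 * Fintype.card R ≤ 5 * #T) {G : Type*} [Group G] [Fintype G] [DecidableEq G]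
    (f : RCyc R q u →* G) (hf : Function.Injective f) : ¬ BoxUseful G := by
  obtain ⟨Y, W, I, hY, hW, hI, hind, hcard⟩ := D.exists_indep_of_pattern u hD hT
  refine not_boxUseful_of_injective f hf hY hW hI hind ?_
  rw [hcard, RCyc.card]
  calc 9 * (Fintype.card R * q) = (9 * Fintype.card R) * q := by ring
    _ ≤ (5 * #T) * q := Nat.mul_le_mul_right _ hbig
    _ = 5 * (#T * q) := by ring

end RBox

end RCyc

/-! ### The Eisenstein groups `𝔽_p[ω] ⋊ C₃` -/

/-- `𝔽_p[ω] = 𝔽_p[X]/(X² + X + 1)` as Mathlib's computable quadratic algebra (`ω² = −1 − ω`). [folklore] -/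
abbrev Eis (p : ℕ) : Type := QuadraticAlgebra (ZMod p) (-1) (-1)

namespace Eis

variable {p : ℕ}

/-- `ω`. [folklore] -/
def w : Eis p := ⟨0, 1⟩

/-- `ω³ = 1`. [folklore] -/
theorem w_cube : (w : Eis p) ^ 3 = 1 := by
  ext <;> simp [w, pow_succ] <;> rfl

/-- `ω³ = 1` as a `Fact` (group law of `EisCyc`). [folklore] -/
instance fact_w_cube : Fact ((w : Eis p) ^ 3 = 1) := ⟨w_cube⟩

/-- `𝔽_p[ω]` is finite (`≃ ZMod p × ZMod p`). [folklore] -/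
instance [NeZero p] : Fintype (Eis p) := Fintype.ofEquiv _ (QuadraticAlgebra.equivProd (-1 : ZMod p) (-1)).symm

/-- `|𝔽_p[ω]| = p²`. [folklore] -/
theorem card [NeZero p] : Fintype.card (Eis p) = p * p := by
  rw [Fintype.ofEquiv_card, Fintype.card_prod, ZMod.card]

end Eis

/-- The Eisenstein group `𝔽_p[ω] ⋊_ω ℤ/3` (order `3p²`; `A₄` for `p = 2`, the Schmidt atom `𝔽_{p²} ⋊ C₃` for `p ≡ 2 (mod 3)`). [folklore] -/
abbrev EisCyc (p : ℕ) : Type := RCyc (Eis p) 3 Eis.w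

/-- `|𝔽_p[ω] ⋊ ℤ/3| = 3p²`. [folklore] -/
theorem EisCyc.card (p : ℕ) [NeZero p] : Fintype.card (EisCyc p) = p * p * 3 := by
  rw [RCyc.card, Eis.card]

end Summit.MatrixMultiplication.OmegaCensus
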